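import Mathlib
import HarnessLib
import Literature.Analysis.FluidPDE.TaoEnstrophyLocalisationProofs
import Literature.Analysis.FluidPDE.PeriodicLerayProfileGradient

/-!
# nsreg-p1 ROUND-15 (planned doors S16 / S16′ / S16γ): weight bookkeeping on `ℝ³` for the profile enstrophy

Scale-invariant bounds `(‖x‖+√(−t))^{m} ‖f(x)‖ ≤ K` of door-class profiles (`PlaneStrainDoorProfileGradientDecay`)
are turned into `L²` statements here:

* `integrable_inv_norm_add_pow` — `x ↦ (‖x‖+a)^{−m}` is integrable on `ℝ³` for `a > 0`, `m ≥ 4`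
  (comparison with Mathlib's `integrable_one_add_norm`);
* `lintegral_enorm_sq_le_of_weight_le`, `lintegral_enorm_sq_lt_top_of_weight_le` — `∫⁻‖f‖ₑ² ≤ ∫⁻ K²(‖x‖+a)^{−2m}`,
  finite for `m ≥ 2`;
* `integral_inv_norm_add_pow_four` — the scaling law `∫ (‖x‖+a)^{−4} dx = a^{−1} ∫ (‖y‖+1)^{−4} dy`;
(`|L|²_F ≤ 3‖L‖²` on `ℝ³` is the tree's `BradshawTsai2017.frobeniusNormSq_le_three_mul_norm_sq`.)

Seat nsreg-p6 g8.  WHAT THIS IS NOT: not NS — measure-theoretic plumbing for the profile enstrophy engine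
`PlaneStrainDoorProfileEnstrophyLiouville`.
-/

noncomputable section

open MeasureTheory Set Function Filter Topology InnerProductSpace
open scoped ENNReal NNReal RealInnerProductSpace
open Literature.Analysis Literature.Analysis.FluidPDE

-- the summit and its single sub-problem share the name (CONVENTIONS §1), as in every Theorems file
set_option linter.dupNamespace false

namespace Summit.NavierStokesRegularity.NavierStokesRegularity.Theorems.PlaneStrainDoorProfileWeights

/-! ### Weights on `ℝ³` -/

/-- `x ↦ (‖x‖ + a)^{−m}` is integrable on `ℝ³` for `a > 0`, `m ≥ 4`. -/
theorem integrable_inv_norm_add_pow {a : ℝ} (ha : 0 < a) {m : ℕ} (hm : 4 ≤ m) :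
    Integrable (fun x : EuclideanSpace ℝ (Fin 3) => ((‖x‖ + a) ^ m)⁻¹) volume := by
  set c : ℝ := min a 1 with hc
  have hc0 : 0 < c := lt_min ha one_pos
  have hca : c ≤ a := min_le_left _ _
  have hc1 : c ≤ 1 := min_le_right _ _
  have hr : (Module.finrank ℝ (EuclideanSpace ℝ (Fin 3)) : ℝ) < (m : ℝ) := by
    rw [finrank_euclideanSpace_fin]; exact_mod_cast (show 3 < m by omega)
  have hint := (integrable_one_add_norm (μ := (volume : Measure (EuclideanSpace ℝ (Fin 3)))) hr).const_mul
    ((c ^ m)⁻¹)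
  have hcont : Continuous fun x : EuclideanSpace ℝ (Fin 3) => ((‖x‖ + a) ^ m)⁻¹ :=
    Continuous.inv₀ ((continuous_norm.add continuous_const).pow m)
      fun x => (pow_pos (add_pos_of_nonneg_of_pos (norm_nonneg _) ha) _).ne'
  refine hint.mono' hcont.aestronglyMeasurable (Eventually.of_forall fun x => ?_)
  have hxa : 0 < ‖x‖ + a := add_pos_of_nonneg_of_pos (norm_nonneg _) ha
  have h1x : 0 < 1 + ‖x‖ := by positivity
  rw [Real.norm_of_nonneg (inv_nonneg.2 (pow_nonneg hxa.le _)),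
    Real.rpow_neg h1x.le, Real.rpow_natCast, ← mul_inv, ← mul_pow]
  refine inv_anti₀ (pow_pos (mul_pos hc0 h1x) _) (pow_le_pow_left₀ (mul_pos hc0 h1x).le ?_ _)
  nlinarith [norm_nonneg x]

/-- `L²`-finiteness from a scale-invariant pointwise bound `(‖x‖+a)^m ‖f(x)‖ ≤ K`, `m ≥ 2`, `a > 0`. -/
theorem lintegral_enorm_sq_lt_top_of_weight_le {F : Type*} [NormedAddCommGroup F]
    {f : EuclideanSpace ℝ (Fin 3) → F} {a K : ℝ} (ha : 0 < a) {m : ℕ} (hm : 2 ≤ m)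
    (hf : ∀ x, (‖x‖ + a) ^ m * ‖f x‖ ≤ K) : ∫⁻ x, ‖f x‖ₑ ^ 2 < ⊤ := by
  have hg := (integrable_inv_norm_add_pow ha (show 4 ≤ 2 * m by omega)).const_mul (K ^ 2)
  have hpt : ∀ x, ‖f x‖ ^ 2 ≤ K ^ 2 * ((‖x‖ + a) ^ (2 * m))⁻¹ := by
    intro x
    have hxa : 0 < (‖x‖ + a) ^ m := pow_pos (add_pos_of_nonneg_of_pos (norm_nonneg _) ha) _
    have h1 : ‖f x‖ ≤ K / (‖x‖ + a) ^ m := by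
      rw [le_div_iff₀ hxa, mul_comm]; exact hf x
    have hK : 0 ≤ K / (‖x‖ + a) ^ m := (norm_nonneg _).trans h1
    calc ‖f x‖ ^ 2 ≤ (K / (‖x‖ + a) ^ m) ^ 2 := pow_le_pow_left₀ (norm_nonneg _) h1 2
      _ = K ^ 2 * ((‖x‖ + a) ^ (2 * m))⁻¹ := by rw [div_pow, ← pow_mul, mul_comm m 2]; ring
  calc ∫⁻ x, ‖f x‖ₑ ^ 2 = ∫⁻ x, ENNReal.ofReal (‖f x‖ ^ 2) := lintegral_congr fun x => by
        rw [← ofReal_norm, ENNReal.ofReal_pow (norm_nonneg _)]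
    _ ≤ ∫⁻ x, ENNReal.ofReal (K ^ 2 * ((‖x‖ + a) ^ (2 * m))⁻¹) :=
        lintegral_mono fun x => ENNReal.ofReal_le_ofReal (hpt x)
    _ ≤ ∫⁻ x, ‖K ^ 2 * ((‖x‖ + a) ^ (2 * m))⁻¹‖ₑ :=
        lintegral_mono fun x => Real.ofReal_le_enorm _
    _ < ⊤ := hg.2

/-- The scaling law `∫ (‖x‖+a)^{−4} dx = a^{−1} ∫ (‖y‖+1)^{−4} dy` on `ℝ³` (`x = a y`). -/
theorem integral_inv_norm_add_pow_four {a : ℝ} (ha : 0 < a) :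
    ∫ x : EuclideanSpace ℝ (Fin 3), ((‖x‖ + a) ^ 4)⁻¹ =
      a⁻¹ * ∫ y : EuclideanSpace ℝ (Fin 3), ((‖y‖ + 1) ^ 4)⁻¹ := by
  have h := Measure.integral_comp_smul (volume : Measure (EuclideanSpace ℝ (Fin 3)))
    (fun x : EuclideanSpace ℝ (Fin 3) => ((‖x‖ + a) ^ 4)⁻¹) a
  have hsub : (fun y : EuclideanSpace ℝ (Fin 3) => ((‖a • y‖ + a) ^ 4)⁻¹) =
      fun y => (a ^ 4)⁻¹ * ((‖y‖ + 1) ^ 4)⁻¹ := by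
    funext y
    rw [norm_smul, Real.norm_of_nonneg ha.le, show a * ‖y‖ + a = a * (‖y‖ + 1) by ring, mul_pow, mul_inv]
  rw [hsub, integral_const_mul, finrank_euclideanSpace_fin, abs_of_pos (inv_pos.2 (pow_pos ha 3)),
    smul_eq_mul] at h
  have ha3 : (a ^ 3)⁻¹ ≠ 0 := inv_ne_zero (pow_ne_zero _ ha.ne')
  have key : ∫ x : EuclideanSpace ℝ (Fin 3), ((‖x‖ + a) ^ 4)⁻¹ =
      a ^ 3 * ((a ^ 4)⁻¹ * ∫ y : EuclideanSpace ℝ (Fin 3), ((‖y‖ + 1) ^ 4)⁻¹) := by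
    rw [h]; field_simp
  rw [key]; field_simp

/-- `∫⁻ ‖f‖ₑ²` under a scale-invariant pointwise bound, against the explicit weight integral. -/
theorem lintegral_enorm_sq_le_of_weight_le {F : Type*} [NormedAddCommGroup F]
    {f : EuclideanSpace ℝ (Fin 3) → F} {a K : ℝ} (ha : 0 < a) {m : ℕ}
    (hf : ∀ x, (‖x‖ + a) ^ m * ‖f x‖ ≤ K) :
    ∫⁻ x, ‖f x‖ₑ ^ 2 ≤ ∫⁻ x : EuclideanSpace ℝ (Fin 3), ‖K ^ 2 * ((‖x‖ + a) ^ (2 * m))⁻¹‖ₑ := by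
  have hpt : ∀ x, ‖f x‖ ^ 2 ≤ K ^ 2 * ((‖x‖ + a) ^ (2 * m))⁻¹ := by
    intro x
    have hxa : 0 < (‖x‖ + a) ^ m := pow_pos (add_pos_of_nonneg_of_pos (norm_nonneg _) ha) _
    have h1 : ‖f x‖ ≤ K / (‖x‖ + a) ^ m := by
      rw [le_div_iff₀ hxa, mul_comm]; exact hf x
    calc ‖f x‖ ^ 2 ≤ (K / (‖x‖ + a) ^ m) ^ 2 := pow_le_pow_left₀ (norm_nonneg _) h1 2
      _ = K ^ 2 * ((‖x‖ + a) ^ (2 * m))⁻¹ := by rw [div_pow, ← pow_mul, mul_comm m 2]; ring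
  calc ∫⁻ x, ‖f x‖ₑ ^ 2 = ∫⁻ x, ENNReal.ofReal (‖f x‖ ^ 2) := lintegral_congr fun x => by
        rw [← ofReal_norm, ENNReal.ofReal_pow (norm_nonneg _)]
    _ ≤ ∫⁻ x, ENNReal.ofReal (K ^ 2 * ((‖x‖ + a) ^ (2 * m))⁻¹) :=
        lintegral_mono fun x => ENNReal.ofReal_le_ofReal (hpt x)
    _ ≤ ∫⁻ x, ‖K ^ 2 * ((‖x‖ + a) ^ (2 * m))⁻¹‖ₑ :=
        lintegral_mono fun x => Real.ofReal_le_enorm _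

end Summit.NavierStokesRegularity.NavierStokesRegularity.Theorems.PlaneStrainDoorProfileWeights

end
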